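import Literature.Computability.Complexity.MonotoneMatchingKWDepth
import Literature.Computability.Complexity.CliqueTestGraphs
import Literature.Computability.Complexity.KWProtocolOfCircuit
import HarnessLib

/-!
# Raz–Wigderson Thm. 4.3 / Cor. 4.1: monotone circuits for CLIQUE need linear depth — PROVED

R. Raz, A. Wigderson, *Monotone circuits for matching require linear depth*, STOC 1990 / J. ACM 39
(1992) (materialised `paper:doi-10-1145-100216-100253`), **Theorem 4.3** (p. 14):
«`d_m(CL((2n/3)+1)) = Ω(n)`.  Proof: A simple reduction from the search problem `M̂` to the relation
`R^m_CL` associated with `CL`.  All we have to observe is that `Q̂_N` are cliques of size `(2n/3)+1`,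
i.e. minterms of `CL`.  Also, `P_N` is a subset of the maxterms of `CL`.  Hence, a protocol for
`R^m_CL` is in fact a protocol for `M̂`, with the names of the players switched», and **Corollary
4.1**: «For every `k ≤ n/2`, `d_m(CL(k)) = Ω(k)`».

Here the same switch is applied to the BIPARTITE search problem of
`MonotoneMatchingKWDepth.lean` (Alice: a perfect matching `α` of `K_{n,n}`; Bob: the edges meeting
a vertex cover `T`, `|T| = n − 1`): on the `2n` vertices `N ∪ N̄` of `K_{n+n}`, Bob's cover becomes
the CLIQUE on the `n + 1` uncovered vertices (a minterm of `CL(2n, n+1)`, `gGraph_bobInput_eq_true`)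
and Alice's matching becomes the complete graph minus the `n` matching edges `{l, ᾱ(l)}` (no
`(n+1)`-clique: two of any `n + 1` vertices carry the same "left name", `hGraph_eq_false`); an edge
of the former missing from the latter is a matching edge with both ends uncovered — a correct answer
of the matching game (`decode_spec`, `correctOn_toBPM`).  Hence (`RWMatching.kwDepth_of_correctOn`):

* `RWClique.clique_monotoneKW_depth` — ★ every protocol tree solving the monotone Karchmer–Wigderson
  game of `cliqueFn (n+n) (n+1)` (`n = 2m + k`, `m ≥ m₀`) has depth `≥ c · m`;
* `RWClique.clique_monotoneDepth` — ★ every monotone circuit computing `cliqueFn (n+n) (n+1)`,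
  `n ≥ n₀`, has depth `≥ c · n` (with the Karchmer–Wigderson simulation
  `Circuit.exists_kwTree_solvesMono`).

The clique function is the tree's `cliqueFn N s` on the edges of `K_N`
(`Literature.Computability.Complexity.CircuitLowerBounds`, API `CliqueTestGraphs`).  The ratio
clique-size : vertices is `1/2` here (print: `2/3`, through the `3m`-vertex matching problem);
`RWClique.clique_monotoneDepth_general` is Cor. 4.1 as printed — every `s ≤ N/2`, depth `≥ c · s` —
by restriction to the first `2(s−1)` vertices (`KWTree.solvesMono_restrict`, `cliqueFn_extendAlong`).
0 named facts.
-/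

noncomputable section
namespace Literature.Computability.Complexity

open Finset Literature.Barriers.PneNP

namespace KWTree

universe u v

variable {ι : Type u} {κ : Type v}

/-- Transport a protocol tree along input encodings `φA`, `φB` and an output decoding `g`
(a reduction between Karchmer–Wigderson games). [cite: RazWigderson1990, §2 Fact 2.1] -/
def transport (φA φB : (ι → Bool) → (κ → Bool)) (g : κ → ι) : KWTree κ → KWTree ι
  | leaf k => leaf (g k)
  | alice s P Q => alice (fun a => s (φA a)) (transport φA φB g P) (transport φA φB g Q)
  | bob s P Q => bob (fun b => s (φB b)) (transport φA φB g P) (transport φA φB g Q)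

/-- Run law of `transport`. [cite: RazWigderson1990, §2 Fact 2.1] -/
@[simp] theorem run_transport (φA φB : (ι → Bool) → (κ → Bool)) (g : κ → ι) :
    ∀ (P : KWTree κ) (a b : ι → Bool), (transport φA φB g P).run a b = g (P.run (φA a) (φB b))
  | leaf _, _, _ => rfl
  | alice s P Q, a, b => by
      simp only [transport, run_alice, run_transport φA φB g P, run_transport φA φB g Q]
      split <;> rfl
  | bob s P Q, a, b => by
      simp only [transport, run_bob, run_transport φA φB g P, run_transport φA φB g Q]
      split <;> rfl

/-- Depth law of `transport`. [cite: RazWigderson1990, §2 Fact 2.1] -/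
@[simp] theorem depth_transport (φA φB : (ι → Bool) → (κ → Bool)) (g : κ → ι) :
    ∀ P : KWTree κ, (transport φA φB g P).depth = P.depth
  | leaf _ => rfl
  | alice _ P Q => by simp only [transport, depth_alice, depth_transport φA φB g P,
      depth_transport φA φB g Q]
  | bob _ P Q => by simp only [transport, depth_bob, depth_transport φA φB g P,
      depth_transport φA φB g Q]

end KWTree

namespace RWClique

variable {n : ℕ}

/-- The coordinates of the clique function: edges of `K_N`. [cite: RazWigderson1990, §4.1 (CL(k))] -/
abbrev Edge (N : ℕ) : Type := (⊤ : SimpleGraph (Fin N)).edgeSet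

/-- The side of a vertex of `K_{n+n}`: left copy `inl l` or right copy `inr r` (RW's vertex
duplication `i ↦ i, ī`). [cite: RazWigderson1990, Thm. 4.2/4.3 (p. 13–14)] -/
def side (u : Fin (n + n)) : Fin n ⊕ Fin n := finSumFinEquiv.symm u

/-- Bob-of-CLIQUE's graph from a bipartite graph `a` (a perfect matching): the complete graph on
the `2n` vertices minus the matching edges `{l, r̄}`, `a(l,r) = 1` — a maxterm of `CL(n+1)`.
[cite: RazWigderson1990, Thm. 4.3 ("P_N is a subset of the maxterms of CL")] -/
def matchPairFun (a : Fin n × Fin n → Bool) (u v : Fin (n + n)) : Bool :=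
  match side u, side v with
  | .inl l, .inr r => !a (l, r)
  | .inr r, .inl l => !a (l, r)
  | .inl _, .inl _ => true
  | .inr _, .inr _ => true

/-- `matchPairFun` is symmetric. [cite: RazWigderson1990, Thm. 4.3] -/
theorem matchPairFun_comm (a : Fin n × Fin n → Bool) (u v : Fin (n + n)) :
    matchPairFun a u v = matchPairFun a v u := by
  unfold matchPairFun
  rcases side u with l | r <;> rcases side v with l' | r' <;> rfl

/-- `H_a` as an input of `cliqueFn (n+n)`. [cite: RazWigderson1990, Thm. 4.3] -/
def hGraph (a : Fin n × Fin n → Bool) : Edge (n + n) → Bool :=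
  fun e => Sym2.lift ⟨matchPairFun a, matchPairFun_comm a⟩ e.1

/-- A vertex is uncovered by Bob's bipartite cover graph `b`: its row/column is not all ones.
[cite: RazWigderson1990, Thm. 4.3 ("Q̂_N are cliques of size 2n/3+1, i.e. minterms of CL")] -/
def unc (b : Fin n × Fin n → Bool) (u : Fin (n + n)) : Bool :=
  match side u with
  | .inl l => decide (∃ r, b (l, r) = false)
  | .inr r => decide (∃ l, b (l, r) = false)

/-- Alice-of-CLIQUE's graph from a bipartite cover graph `b`: the clique on the uncovered vertices.
[cite: RazWigderson1990, Thm. 4.3] -/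
def gGraph (b : Fin n × Fin n → Bool) : Edge (n + n) → Bool :=
  fun e => Sym2.lift ⟨fun u v => unc b u && unc b v, fun _ _ => Bool.and_comm _ _⟩ e.1

/-- Decoding an edge `{l, r̄}` of `K_{n+n}` to the bipartite pair `(l, r)` (junk `d` on same-side
edges). [cite: RazWigderson1990, Thm. 4.2 ("any solution (i, j̄) or (j, ī) … corresponds to a
solution (i, j)")] -/
def decodeFun (d : Fin n × Fin n) (u v : Fin (n + n)) : Fin n × Fin n :=
  match side u, side v with
  | .inl l, .inr r => (l, r)
  | .inr r, .inl l => (l, r)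
  | .inl _, .inl _ => d
  | .inr _, .inr _ => d

/-- `decodeFun` is symmetric. [cite: RazWigderson1990, Thm. 4.2] -/
theorem decodeFun_comm (d : Fin n × Fin n) (u v : Fin (n + n)) :
    decodeFun d u v = decodeFun d v u := by
  unfold decodeFun
  rcases side u with l | r <;> rcases side v with l' | r' <;> rfl

/-- The decoding on edges. [cite: RazWigderson1990, Thm. 4.2] -/
def decode (d : Fin n × Fin n) : Edge (n + n) → Fin n × Fin n :=
  fun e => Sym2.lift ⟨decodeFun d, decodeFun_comm d⟩ e.1

/-- The protocol tree for the bipartite matching game obtained from a tree for the clique game: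
players swapped, inputs encoded by `hGraph`/`gGraph`, answers decoded. [cite: RazWigderson1990,
Thm. 4.3 ("a protocol for R^m_CL is in fact a protocol for M̂, with the names of the players
switched")] -/
def toBPM (d : Fin n × Fin n) (P : KWTree (Edge (n + n))) : KWTree (Fin n × Fin n) :=
  KWTree.transport hGraph gGraph (decode d) P.swap

/-- Run law of `toBPM`. [cite: RazWigderson1990, Thm. 4.3] -/
theorem run_toBPM (d : Fin n × Fin n) (P : KWTree (Edge (n + n))) (a b : Fin n × Fin n → Bool) :
    (toBPM d P).run a b = decode d (P.run (gGraph b) (hGraph a)) := by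
  simp [toBPM]

/-- `toBPM` preserves depth. [cite: RazWigderson1990, Thm. 4.3] -/
theorem depth_toBPM (d : Fin n × Fin n) (P : KWTree (Edge (n + n))) : (toBPM d P).depth = P.depth := by
  simp [toBPM]

/-! ### The two encoded inputs are a minterm and a maxterm of `CL(n+n, n+1)` -/

/-- A vertex with `side u = inl l` is the left copy of `l`. [folklore] -/
private theorem eq_of_side_inl {u : Fin (n + n)} {l : Fin n} (h : side u = .inl l) :
    u = finSumFinEquiv (Sum.inl l) := by
  unfold side at h
  rw [← h, Equiv.apply_symm_apply]

/-- A vertex with `side u = inr r` is the right copy of `r`. [folklore] -/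
private theorem eq_of_side_inr {u : Fin (n + n)} {r : Fin n} (h : side u = .inr r) :
    u = finSumFinEquiv (Sum.inr r) := by
  unfold side at h
  rw [← h, Equiv.apply_symm_apply]

/-- The side of a left copy. [folklore] -/
@[simp] private theorem side_inl (l : Fin n) : side (finSumFinEquiv (Sum.inl l) : Fin (n + n)) = .inl l := by
  simp only [side, Equiv.symm_apply_apply]

/-- The side of a right copy. [folklore] -/
@[simp] private theorem side_inr (r : Fin n) : side (finSumFinEquiv (Sum.inr r) : Fin (n + n)) = .inr r := by
  simp only [side, Equiv.symm_apply_apply]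

/-- **`H_σ` has no `(n+1)`-clique** when `a` is the graph of a bijection `σ` (a perfect matching):
among `n + 1` vertices two have the same "left name" (`l` for `l`, `σ⁻¹ r` for `r̄`), and such a pair
is a missing matching edge. [cite: RazWigderson1990, Thm. 4.3 ("P_N is a subset of the maxterms of
CL")] -/
theorem hGraph_eq_false (σ : Equiv.Perm (Fin n)) :
    cliqueFn (n + n) (n + 1) (hGraph fun p : Fin n × Fin n => decide (σ p.1 = p.2)) = false := by
  classical
  rw [cliqueFn_eq_false_iff]
  intro S hS
  rw [SimpleGraph.isNClique_iff] at hS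
  obtain ⟨hcl, hcard⟩ := hS
  -- pigeonhole on the left names
  let f : Fin (n + n) → Fin n := fun u => match side u with
    | .inl l => l
    | .inr r => σ.symm r
  obtain ⟨u, hu, v, hv, huv, hf⟩ := Finset.exists_ne_map_eq_of_card_lt_of_maps_to
    (s := S) (t := (Finset.univ : Finset (Fin n))) (by simp [hcard]) (fun u _ => Finset.mem_univ (f u))
  have hadj := hcl hu hv huv
  rw [cliqueGraph_adj] at hadj
  obtain ⟨hne, hx⟩ := hadj
  simp only [hGraph, Sym2.lift_mk] at hx
  rcases hsu : side u with l | r <;> rcases hsv : side v with l' | r' <;>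
    simp only [f, matchPairFun, hsu, hsv] at hf hx
  · exact absurd (by rw [eq_of_side_inl hsu, eq_of_side_inl hsv, hf]) huv
  · simp only [Bool.not_eq_true', decide_eq_false_iff_not] at hx
    exact hx (by rw [hf, Equiv.apply_symm_apply])
  · simp only [Bool.not_eq_true', decide_eq_false_iff_not] at hx
    exact hx (by rw [← hf, Equiv.apply_symm_apply])
  · exact absurd (by rw [eq_of_side_inr hsu, eq_of_side_inr hsv, σ.symm.injective hf]) huv

/-- `inTL` vanishes exactly at the removed point and at the vertices `(i,0)`, `i ∈ y`.
[cite: RazWigderson1990, Prop. 3.2–3.4] -/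
theorem inTL_eq_false_iff {m k : ℕ} (hm : 0 < m) (y : Finset (Fin m)) (w : RWMatching.Vert m k) :
    RWMatching.inTL hm y w = false ↔ w = RWMatching.rmv hm ∨ ∃ i ∈ y, w = .inl (i, false) := by
  rcases w with ⟨i, β⟩ | j
  · cases β
    · simp [RWMatching.inTL, RWMatching.rmv]
    · by_cases hi : i = ⟨0, hm⟩
      · subst hi; simp [RWMatching.inTL, RWMatching.rmv]
      · simp [RWMatching.inTL, RWMatching.rmv, hi]
  · simp [RWMatching.inTL, RWMatching.rmv]

/-- `inTR` holds exactly at the vertices `(i,1)`, `i ∈ y`. [cite: RazWigderson1990, Prop. 3.3/3.4] -/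
theorem inTR_eq_true_iff {m k : ℕ} (y : Finset (Fin m)) (w : RWMatching.Vert m k) :
    RWMatching.inTR y w = true ↔ ∃ i ∈ y, w = .inl (i, true) := by
  rcases w with ⟨i, β⟩ | j
  · cases β <;> simp [RWMatching.inTR]
  · simp [RWMatching.inTR]

variable {m k : ℕ}

/-- A left vertex is uncovered by `bobInput` iff it is outside `T_L`. [cite: RazWigderson1990, Thm. 4.3] -/
theorem unc_bobInput_inl (hm : 0 < m) (y : Finset (Fin m)) (e : RWMatching.Relab m k n) (l : Fin n) :
    unc (RWMatching.bobInput hm y e) (finSumFinEquiv (Sum.inl l)) =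
      !RWMatching.inTL hm y (e.1.symm l) := by
  simp only [unc, side_inl]
  cases h : RWMatching.inTL hm y (e.1.symm l)
  · simp only [Bool.not_false, decide_eq_true_eq]
    refine ⟨e.2 (Sum.inl (⟨0, hm⟩, false)), ?_⟩
    simp [RWMatching.bobInput, h, RWMatching.inTR]
  · simp [RWMatching.bobInput, h]

/-- A right vertex is uncovered by `bobInput` iff it is outside `T_R`. [cite: RazWigderson1990, Thm. 4.3] -/
theorem unc_bobInput_inr (hm : 0 < m) (y : Finset (Fin m)) (e : RWMatching.Relab m k n) (r : Fin n) :
    unc (RWMatching.bobInput hm y e) (finSumFinEquiv (Sum.inr r)) =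
      !RWMatching.inTR y (e.2.symm r) := by
  simp only [unc, side_inr]
  cases h : RWMatching.inTR y (e.2.symm r)
  · simp only [Bool.not_false, decide_eq_true_eq]
    refine ⟨e.1 (RWMatching.rmv hm), ?_⟩
    simp [RWMatching.bobInput, h]
  · simp [RWMatching.bobInput, h]

/-- **`G_T` has an `(n+1)`-clique**: the uncovered vertices — `|y| + 1` on the left (`v` and the
`(i,0)`, `i ∈ y`) and `n − |y|` on the right (all but the `(i,1)̄`, `i ∈ y`) — are pairwise
adjacent. [cite: RazWigderson1990, Thm. 4.3 ("Q̂_N are cliques of size (2n/3)+1, i.e. minterms of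
CL")] -/
theorem gGraph_bobInput_eq_true (hm : 0 < m) (y : Finset (Fin m)) (e : RWMatching.Relab m k n) :
    cliqueFn (n + n) (n + 1) (gGraph (RWMatching.bobInput hm y e)) = true := by
  classical
  rw [cliqueFn_eq_true_iff]
  intro hfree
  let SL : Finset (Fin n) := Finset.univ.filter fun l => RWMatching.inTL hm y (e.1.symm l) = false
  let SR : Finset (Fin n) := Finset.univ.filter fun r => RWMatching.inTR y (e.2.symm r) = false
  let iL : Fin n ↪ Fin (n + n) := ⟨fun l => finSumFinEquiv (Sum.inl l), fun a b h => by
    simpa using finSumFinEquiv.injective h⟩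
  let iR : Fin n ↪ Fin (n + n) := ⟨fun r => finSumFinEquiv (Sum.inr r), fun a b h => by
    simpa using finSumFinEquiv.injective h⟩
  let S : Finset (Fin (n + n)) := SL.map iL ∪ SR.map iR
  have hunc : ∀ w ∈ S, unc (RWMatching.bobInput hm y e) w = true := by
    intro w hw
    simp only [S, Finset.mem_union, Finset.mem_map, SL, SR, Finset.mem_filter, Finset.mem_univ,
      true_and] at hw
    rcases hw with ⟨l, hl, rfl⟩ | ⟨r, hr, rfl⟩
    · change unc _ (finSumFinEquiv (Sum.inl l)) = true
      rw [unc_bobInput_inl, hl]; rfl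
    · change unc _ (finSumFinEquiv (Sum.inr r)) = true
      rw [unc_bobInput_inr, hr]; rfl
  refine hfree S ⟨?_, ?_⟩
  · -- pairwise adjacent
    intro u hu v hv huv
    rw [cliqueGraph_adj]
    refine ⟨huv, ?_⟩
    simp only [gGraph, Sym2.lift_mk, Bool.and_eq_true]
    exact ⟨hunc u (Finset.mem_coe.1 hu), hunc v (Finset.mem_coe.1 hv)⟩
  · -- exactly `n + 1` of them
    have hdisj : Disjoint (SL.map iL) (SR.map iR) := by
      rw [Finset.disjoint_left]
      intro w h1 h2
      simp only [Finset.mem_map] at h1 h2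
      obtain ⟨l, -, rfl⟩ := h1
      obtain ⟨r, -, h⟩ := h2
      exact absurd (finSumFinEquiv.injective h) (by simp)
    rw [Finset.card_union_of_disjoint hdisj, Finset.card_map, Finset.card_map]
    -- count on `V` through the bijections `e_L`, `e_R`
    have hcardV : Fintype.card (RWMatching.Vert m k) = n := by
      simpa using Fintype.card_congr e.1
    have hSL : SL.card = y.card + 1 := by
      have hSL' : SL = (insert (RWMatching.rmv hm) (y.map ⟨fun i => Sum.inl (i, false),
          fun i j h => by simpa using h⟩) : Finset (RWMatching.Vert m k)).map e.1.toEmbedding := by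
        ext l
        simp only [SL, Finset.mem_filter, Finset.mem_univ, true_and, Finset.mem_map,
          Finset.mem_insert, Function.Embedding.coeFn_mk, inTL_eq_false_iff]
        constructor
        · rintro (h | ⟨i, hi, h⟩)
          · exact ⟨_, Or.inl rfl, by rw [← h, Equiv.apply_symm_apply]⟩
          · exact ⟨_, Or.inr ⟨i, hi, rfl⟩, by rw [← h, Equiv.apply_symm_apply]⟩
        · rintro ⟨w, hw, rfl⟩
          rw [Equiv.symm_apply_apply]
          rcases hw with rfl | ⟨i, hi, rfl⟩
          · exact Or.inl rfl
          · exact Or.inr ⟨i, hi, rfl⟩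
      rw [hSL', Finset.card_map, Finset.card_insert_of_notMem (by simp [RWMatching.rmv]),
        Finset.card_map]
    have hSR : SR.card + y.card = n := by
      have hB : (Finset.univ.filter fun w : RWMatching.Vert m k => RWMatching.inTR y w = true) =
          y.map ⟨fun i => Sum.inl (i, true), fun i j h => by simpa using h⟩ := by
        ext w
        simp only [Finset.mem_filter, Finset.mem_univ, true_and, Finset.mem_map,
          Function.Embedding.coeFn_mk, inTR_eq_true_iff]
        constructor
        · rintro ⟨i, hi, rfl⟩; exact ⟨i, hi, rfl⟩
        · rintro ⟨i, hi, rfl⟩; exact ⟨i, hi, rfl⟩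
      have hSR' : SR = (Finset.univ.filter fun w : RWMatching.Vert m k =>
          RWMatching.inTR y w = false).map e.2.toEmbedding := by
        ext r
        simp only [SR, Finset.mem_filter, Finset.mem_univ, true_and, Finset.mem_map,
          Equiv.coe_toEmbedding]
        constructor
        · intro h; exact ⟨e.2.symm r, h, Equiv.apply_symm_apply _ _⟩
        · rintro ⟨w, hw, rfl⟩; rwa [Equiv.symm_apply_apply]
      have hsplit := Finset.card_filter_add_card_filter_not
        (s := (Finset.univ : Finset (RWMatching.Vert m k))) (p := fun w => RWMatching.inTR y w = false)
      have hneg : (Finset.univ.filter fun w : RWMatching.Vert m k => ¬RWMatching.inTR y w = false) =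
          Finset.univ.filter fun w : RWMatching.Vert m k => RWMatching.inTR y w = true := by
        ext w; simp
      rw [hneg, hB, Finset.card_map, Finset.card_univ, hcardV] at hsplit
      rw [hSR', Finset.card_map]
      exact hsplit
    have hy : y.card ≤ m := by simpa using Finset.card_le_univ y
    omega

/-- What a correct answer of the clique game decodes to: a matching edge `(l, r)` (`a(l,r) = 1`)
whose ends are both uncovered. [cite: RazWigderson1990, Thm. 4.2 ("any solution (i, j̄) or (j, ī)
to the new problem corresponds to a solution (i, j) for the original problem")] -/
theorem decode_spec (d : Fin n × Fin n) (a b : Fin n × Fin n → Bool) (ε : Edge (n + n))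
    (h1 : gGraph b ε = true) (h2 : hGraph a ε = false) :
    a (decode d ε) = true ∧ (∃ r, b ((decode d ε).1, r) = false) ∧
      ∃ l, b (l, (decode d ε).2) = false := by
  obtain ⟨ε, hmem⟩ := ε
  revert hmem h1 h2
  refine Sym2.ind (fun u v => ?_) ε
  intro hmem h1 h2
  simp only [gGraph, hGraph, decode, Sym2.lift_mk, Bool.and_eq_true] at h1 h2 ⊢
  rcases hsu : side u with l | r <;> rcases hsv : side v with l' | r' <;>
    simp only [matchPairFun, decodeFun, unc, hsu, hsv, decide_eq_true_eq, Bool.not_eq_false'] at h1 h2 ⊢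
  · exact absurd h2 (by decide)
  · exact ⟨h2, h1.1, h1.2⟩
  · exact ⟨h2, h1.2, h1.1⟩
  · exact absurd h2 (by decide)

/-- **The transported tree is correct on the encoded pairs** (so the bipartite reduction applies).
[cite: RazWigderson1990, Thm. 4.3] -/
theorem correctOn_toBPM (hm : 0 < m) (d : Fin n × Fin n) {P : KWTree (Edge (n + n))}
    (hP : P.SolvesMono (cliqueFn (n + n) (n + 1))) :
    RWMatching.CorrectOn k hm (toBPM d P) := by
  intro x y e
  rw [run_toBPM]
  have ha : cliqueFn (n + n) (n + 1) (hGraph (RWMatching.aliceInput x e)) = false := by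
    have : RWMatching.aliceInput x e = fun p : Fin n × Fin n =>
        decide ((e.1.symm.trans ((RWMatching.alicePerm (r := k) x).trans e.2)) p.1 = p.2) := by
      funext p; simp [RWMatching.aliceInput]
    rw [this]
    exact hGraph_eq_false _
  obtain ⟨h1, h2⟩ := hP _ _ (gGraph_bobInput_eq_true hm y e) ha
  obtain ⟨hA, ⟨r, hr⟩, ⟨l, hl⟩⟩ := decode_spec d _ _ _ h1 h2
  refine ⟨hA, ?_⟩
  simp only [RWMatching.bobInput, Bool.or_eq_false_iff] at hr hl ⊢
  exact ⟨hr.1, hl.2⟩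

/-! ### The depth bounds -/

/-- ★ **Raz–Wigderson Thm. 4.3 / Cor. 4.1, communication form: the monotone Karchmer–Wigderson game
of `CLIQUE(2n, n+1)` needs `Ω(n)` bits.**  There are `c > 0`, `m₀` such that for `m ≥ m₀`,
`n = 2m + k`: every protocol tree solving the monotone game of `cliqueFn (n+n) (n+1)` has depth
`≥ c · m`.  (Print: `d_m(CL((2n/3)+1)) = Ω(n)`, `d_m(CL(k)) = Ω(k)` for `k ≤ n/2`, through the
`3m`-vertex matching problem; here through the bipartite one, whence the ratio `1/2`.)
[cite: RazWigderson1990, Thm. 4.3 and Cor. 4.1 (p. 14)] -/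
theorem clique_monotoneKW_depth :
    ∃ c : ℝ, 0 < c ∧ ∃ m₀ : ℕ, ∀ (m k n : ℕ), m₀ ≤ m → 2 * m + k = n →
      ∀ P : KWTree (Edge (n + n)), P.SolvesMono (cliqueFn (n + n) (n + 1)) →
        c * m ≤ (P.depth : ℝ) := by
  obtain ⟨c, hc, m₀, H⟩ := RWMatching.kwDepth_of_correctOn
  refine ⟨c, hc, max m₀ 1, fun m k n hm hn P hP => ?_⟩
  have hm0 : 0 < m := lt_of_lt_of_le (Nat.lt_of_lt_of_le Nat.zero_lt_one (le_max_right m₀ 1)) hm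
  have hn0 : 0 < n := by omega
  have h := H m k n hm0 (le_trans (le_max_left _ _) hm) hn (toBPM (⟨0, hn0⟩, ⟨0, hn0⟩) P)
    (correctOn_toBPM hm0 _ hP)
  rwa [depth_toBPM] at h

/-- ★ **Raz–Wigderson Thm. 4.3, circuit form: monotone circuits for `CLIQUE(2n, n+1)` have depth
`Ω(n)`.**  There are `c > 0`, `n₀` such that for `n ≥ n₀` every monotone circuit (`{∧₂, ∨₂}`)
computing `cliqueFn (n+n) (n+1)` has depth `≥ c · n` — by the Karchmer–Wigderson simulation
(`Circuit.exists_kwTree_solvesMono`) and `clique_monotoneKW_depth`.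
[cite: RazWigderson1990, Thm. 4.3 (p. 14) with Thm. 2.1 (KW)] -/
theorem clique_monotoneDepth :
    ∃ c : ℝ, 0 < c ∧ ∃ n₀ : ℕ, ∀ n ≥ n₀, ∀ C : Circuit (Edge (n + n)),
      C.IsOver monotoneBasis → C.Computes (cliqueFn (n + n) (n + 1)) → c * n ≤ (C.depth : ℝ) := by
  obtain ⟨c, hc, m₀, H⟩ := clique_monotoneKW_depth
  refine ⟨c / 4, by positivity, 2 * m₀ + 4, fun n hn C hO hC => ?_⟩
  obtain ⟨T, hT, hd⟩ := C.exists_kwTree_solvesMono hO hC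
  have key := H (n / 2) (n % 2) n (by omega) (by omega) T hT
  have h1 : (T.depth : ℝ) ≤ C.depth := by exact_mod_cast hd
  have h2 : (n : ℝ) ≤ 2 * ((n / 2 : ℕ) : ℝ) + 1 := by
    have : n ≤ 2 * (n / 2) + 1 := by omega
    exact_mod_cast this
  have h3 : (4 : ℝ) ≤ n := by exact_mod_cast (by omega : 4 ≤ n)
  have h4 : c * n ≤ c * (2 * ((n / 2 : ℕ) : ℝ) + 1) := mul_le_mul_of_nonneg_left h2 hc.le
  have h5 : c * 4 ≤ c * n := mul_le_mul_of_nonneg_left h3 hc.le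
  linarith

/-! ### Corollary 4.1: all clique sizes `s ≤ N/2`, by restriction to the first `2(s−1)` vertices -/

end RWClique

namespace KWTree

universe u' v'

variable {ι : Type u'} {κ : Type v'}

/-- Extend an input on `ι` by zeros along a map `emb : ι → κ` (restriction of a monotone function:
the coordinates off the image are fixed to `0`). [cite: RazWigderson1990, §2 Fact 2.1 (restrictions
of relations)] -/
def extendAlong [Fintype ι] [DecidableEq κ] (emb : ι → κ) (x : ι → Bool) : κ → Bool :=
  fun k => decide (∃ i, emb i = k ∧ x i = true)

/-- Pull a coordinate back along `emb` (junk `d` off the image). [cite: RazWigderson1990, §2 Fact 2.1] -/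
def pullAlong [Fintype ι] [DecidableEq κ] (d : ι) (emb : ι → κ) (k : κ) : ι :=
  if h : ∃ i, emb i = k then h.choose else d

/-- The extension agrees with `x` on the image of an injective `emb`. [cite: RazWigderson1990, §2 Fact 2.1] -/
theorem extendAlong_apply [Fintype ι] [DecidableEq κ] {emb : ι → κ} (hemb : Function.Injective emb)
    (x : ι → Bool) (i : ι) : extendAlong emb x (emb i) = x i := by
  unfold extendAlong
  cases hx : x i
  · rw [decide_eq_false_iff_not]
    rintro ⟨j, hj, hxj⟩
    rw [hemb hj] at hxj
    rw [hx] at hxj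
    exact Bool.false_ne_true hxj
  · rw [decide_eq_true_eq]
    exact ⟨i, rfl, hx⟩

/-- The extension is `0` off the image. [cite: RazWigderson1990, §2 Fact 2.1] -/
theorem extendAlong_eq_true [Fintype ι] [DecidableEq κ] {emb : ι → κ} {x : ι → Bool} {k : κ}
    (h : extendAlong emb x k = true) : ∃ i, emb i = k ∧ x i = true := by
  unfold extendAlong at h
  exact of_decide_eq_true h

/-- `pullAlong` inverts an injective `emb` on its image. [cite: RazWigderson1990, §2 Fact 2.1] -/
theorem pullAlong_apply [Fintype ι] [DecidableEq κ] (d : ι) {emb : ι → κ}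
    (hemb : Function.Injective emb) (i : ι) : pullAlong d emb (emb i) = i := by
  unfold pullAlong
  have h : ∃ j, emb j = emb i := ⟨i, rfl⟩
  rw [dif_pos h]
  exact hemb h.choose_spec

/-- **Restriction of a monotone Karchmer–Wigderson game**: a protocol for the monotone game of `f`
on `κ` yields one of the same depth for the restriction `x ↦ f (x extended by zeros)` on `ι`
(RW Fact 2.1: `c(R') ≤ c(R)` for a restriction `R'` of `R`). [cite: RazWigderson1990, §2 Fact 2.1] -/
theorem solvesMono_restrict [Fintype ι] [DecidableEq κ] (d : ι) {emb : ι → κ}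
    (hemb : Function.Injective emb) (f : (κ → Bool) → Bool) {P : KWTree κ} (hP : P.SolvesMono f) :
    (transport (extendAlong emb) (extendAlong emb) (pullAlong d emb) P).SolvesMono
      (fun x => f (extendAlong emb x)) := by
  intro a b ha hb
  rw [run_transport]
  obtain ⟨h1, h2⟩ := hP _ _ ha hb
  obtain ⟨i, hi, hai⟩ := extendAlong_eq_true h1
  rw [← hi, pullAlong_apply d hemb]
  rw [← hi, extendAlong_apply hemb] at h2
  exact ⟨hai, h2⟩

end KWTree

namespace RWClique

variable {M N : ℕ}

/-- The edge embedding `K_M ↪ K_N` induced by `Fin.castLE` (RW Cor. 4.1: `CL(k)` on `n` vertices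
restricts to the first vertices). [cite: RazWigderson1990, Cor. 4.1 (p. 14)] -/
def embE (h : M ≤ N) (ε : Edge M) : Edge N :=
  ⟨Sym2.map (Fin.castLE h) ε.1, by
    obtain ⟨e, he⟩ := ε
    revert he
    refine Sym2.ind (fun u v => ?_) e
    intro he
    simp only [Sym2.map_mk, SimpleGraph.mem_edgeSet, SimpleGraph.top_adj, ne_eq] at he ⊢
    exact fun h' => he (Fin.castLE_injective h h')⟩

/-- `embE` is injective. [cite: RazWigderson1990, Cor. 4.1] -/
theorem embE_injective (h : M ≤ N) : Function.Injective (embE h) := by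
  intro ε ε' hε
  apply Subtype.ext
  have := congrArg Subtype.val hε
  exact Sym2.map.injective (Fin.castLE_injective h) this

/-- The vertex embedding as a `Finset` embedding. [cite: RazWigderson1990, Cor. 4.1] -/
def embV (h : M ≤ N) : Fin M ↪ Fin N := ⟨Fin.castLE h, Fin.castLE_injective h⟩

/-- `embE` on an explicit edge. [cite: RazWigderson1990, Cor. 4.1] -/
theorem embE_mk (h : M ≤ N) (u v : Fin M) (huv : u ≠ v) :
    embE h ⟨s(u, v), by simpa using huv⟩ =
      ⟨s(Fin.castLE h u, Fin.castLE h v), by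
        simpa using fun e => huv (Fin.castLE_injective h e)⟩ :=
  Subtype.ext (by simp [embE])

/-- The extended input on an embedded edge. [cite: RazWigderson1990, Cor. 4.1] -/
theorem extendAlong_embE_mk (h : M ≤ N) (x : Edge M → Bool) (u v : Fin M) (huv : u ≠ v)
    (huv' : Fin.castLE h u ≠ Fin.castLE h v) :
    KWTree.extendAlong (embE h) x ⟨s(Fin.castLE h u, Fin.castLE h v), by simpa using huv'⟩ =
      x ⟨s(u, v), by simpa using huv⟩ := by
  rw [← KWTree.extendAlong_apply (embE_injective h) x ⟨s(u, v), by simpa using huv⟩, embE_mk h u v huv]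

/-- Adjacency in the extended graph between embedded vertices. [cite: RazWigderson1990, Cor. 4.1] -/
theorem adj_extendAlong_iff (h : M ≤ N) (x : Edge M → Bool) (u v : Fin M) :
    (cliqueGraph (KWTree.extendAlong (embE h) x)).Adj (Fin.castLE h u) (Fin.castLE h v) ↔
      (cliqueGraph x).Adj u v := by
  rw [cliqueGraph_adj, cliqueGraph_adj]
  constructor
  · rintro ⟨hne, hxe⟩
    have hne' : u ≠ v := fun huv => hne (by rw [huv])
    exact ⟨hne', by rwa [extendAlong_embE_mk h x u v hne' hne] at hxe⟩
  · rintro ⟨hne, hxe⟩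
    have hne' : Fin.castLE h u ≠ Fin.castLE h v := fun huv => hne (Fin.castLE_injective h huv)
    exact ⟨hne', by rwa [extendAlong_embE_mk h x u v hne hne']⟩

/-- Vertices outside the image are isolated in the extended graph. [cite: RazWigderson1990, Cor. 4.1] -/
theorem exists_eq_castLE_of_adj (h : M ≤ N) (x : Edge M → Bool) {u' v' : Fin N}
    (huv : (cliqueGraph (KWTree.extendAlong (embE h) x)).Adj u' v') : ∃ u, Fin.castLE h u = u' := by
  rw [cliqueGraph_adj] at huv
  obtain ⟨hne, hxe⟩ := huv
  obtain ⟨ε, hε, -⟩ := KWTree.extendAlong_eq_true hxe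
  have hval := congrArg Subtype.val hε
  simp only [embE] at hval
  have hmem : u' ∈ Sym2.map (Fin.castLE h) ε.1 := by rw [hval]; exact Sym2.mem_mk_left _ _
  rw [Sym2.mem_map] at hmem
  obtain ⟨u, -, hu⟩ := hmem
  exact ⟨u, hu⟩

/-- **`CL(M, s)` is the restriction of `CL(N, s)` to the first `M` vertices** (`M ≤ N`, `s ≥ 2`:
the padding vertices are isolated, so `s`-cliques live inside the image).
[cite: RazWigderson1990, Cor. 4.1 (p. 14)] -/
theorem cliqueFn_extendAlong (h : M ≤ N) {s : ℕ} (hs : 2 ≤ s) (x : Edge M → Bool) :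
    cliqueFn N s (KWTree.extendAlong (embE h) x) = cliqueFn M s x := by
  classical
  rw [Bool.eq_iff_iff, cliqueFn_eq_true_iff, cliqueFn_eq_true_iff, not_iff_not]
  constructor
  · intro hfree S hS
    refine hfree (S.map (embV h)) ?_
    rw [SimpleGraph.isNClique_iff] at hS ⊢
    refine ⟨?_, by rw [Finset.card_map]; exact hS.2⟩
    intro u' hu' v' hv' hne
    rw [Finset.coe_map] at hu' hv'
    obtain ⟨u, hu, rfl⟩ := hu'
    obtain ⟨v, hv, rfl⟩ := hv'
    exact (adj_extendAlong_iff h x u v).2 (hS.1 hu hv fun huv => hne (by simp [huv]))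
  · intro hfree S' hS'
    rw [SimpleGraph.isNClique_iff] at hS'
    obtain ⟨hcl, hcard⟩ := hS'
    have himg : ∀ u' ∈ S', ∃ u, Fin.castLE h u = u' := by
      intro u' hu'
      obtain ⟨v', hv', hne⟩ : ∃ v' ∈ S', v' ≠ u' := by
        by_contra hcon
        have hsub : S' ⊆ {u'} := fun v hv =>
          Finset.mem_singleton.2 (by_contra fun hne => hcon ⟨v, hv, hne⟩)
        have := Finset.card_le_card hsub
        rw [Finset.card_singleton, hcard] at this
        omega
      exact exists_eq_castLE_of_adj h x (hcl hu' hv' hne.symm)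
    let S : Finset (Fin M) := Finset.univ.filter fun u => Fin.castLE h u ∈ S'
    refine hfree S ?_
    rw [SimpleGraph.isNClique_iff]
    refine ⟨?_, ?_⟩
    · intro u hu v hv hne
      simp only [S, Finset.coe_filter, Finset.mem_univ, true_and, Set.mem_setOf_eq] at hu hv
      exact (adj_extendAlong_iff h x u v).1 (hcl hu hv fun huv => hne (Fin.castLE_injective h huv))
    · have hmap : S.map (embV h) = S' := by
        ext u'
        simp only [S, Finset.mem_map, Finset.mem_filter, Finset.mem_univ, true_and, embV,
          Function.Embedding.coeFn_mk]
        constructor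
        · rintro ⟨u, hu, rfl⟩; exact hu
        · intro hu'
          obtain ⟨u, rfl⟩ := himg u' hu'
          exact ⟨u, hu', rfl⟩
      rw [← hcard, ← hmap, Finset.card_map]

/-- ★ **Raz–Wigderson Cor. 4.1, circuit form: `d_m(CL(N, s)) = Ω(s)` for `s ≤ N/2`.**  There are
`c > 0` and `s₀` such that for all `N, s` with `s₀ ≤ s` and `2s ≤ N`, every monotone circuit
(`{∧₂, ∨₂}`) computing `cliqueFn N s` has depth `≥ c · s`: restrict to the first `2(s−1)` vertices
(`cliqueFn_extendAlong`, `KWTree.solvesMono_restrict`) and apply `clique_monotoneKW_depth`.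
[cite: RazWigderson1990, Cor. 4.1 (p. 14: "For every k = k(n) ≤ n/2, d_m(CL(k)) = Ω(k)")] -/
theorem clique_monotoneDepth_general :
    ∃ c : ℝ, 0 < c ∧ ∃ s₀ : ℕ, ∀ (N s : ℕ), s₀ ≤ s → 2 * s ≤ N → ∀ C : Circuit (Edge N),
      C.IsOver monotoneBasis → C.Computes (cliqueFn N s) → c * s ≤ (C.depth : ℝ) := by
  classical
  obtain ⟨c, hc, m₀, H⟩ := clique_monotoneKW_depth
  refine ⟨c / 8, by positivity, 2 * m₀ + 8, fun N s hs hN C hO hC => ?_⟩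
  obtain ⟨T, hT, hd⟩ := C.exists_kwTree_solvesMono hO hC
  obtain ⟨n, rfl⟩ : ∃ n, s = n + 1 := ⟨s - 1, by omega⟩
  have hle : n + n ≤ N := by omega
  have h0 : 0 < n + n := by omega
  have h1 : 1 < n + n := by omega
  let d : Edge (n + n) := ⟨s(⟨0, h0⟩, ⟨1, h1⟩), by simp⟩
  have hT' := KWTree.solvesMono_restrict d (embE_injective hle) (cliqueFn N (n + 1)) hT
  have hfun : (fun x => cliqueFn N (n + 1) (KWTree.extendAlong (embE hle) x)) =
      cliqueFn (n + n) (n + 1) := by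
    funext x
    exact cliqueFn_extendAlong hle (by omega) x
  rw [hfun] at hT'
  have key := H (n / 2) (n % 2) n (by omega) (by omega) _ hT'
  rw [KWTree.depth_transport] at key
  have hd' : (T.depth : ℝ) ≤ C.depth := by exact_mod_cast hd
  have h2 : ((n + 1 : ℕ) : ℝ) ≤ 2 * ((n / 2 : ℕ) : ℝ) + 3 := by
    have : n + 1 ≤ 2 * (n / 2) + 3 := by omega
    exact_mod_cast this
  have h3 : (8 : ℝ) ≤ ((n + 1 : ℕ) : ℝ) := by exact_mod_cast (by omega : 8 ≤ n + 1)
  have h4 : c * ((n + 1 : ℕ) : ℝ) ≤ c * (2 * ((n / 2 : ℕ) : ℝ) + 3) :=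
    mul_le_mul_of_nonneg_left h2 hc.le
  have h5 : c * 8 ≤ c * ((n + 1 : ℕ) : ℝ) := mul_le_mul_of_nonneg_left h3 hc.le
  linarith

end RWClique

end Literature.Computability.Complexity

end
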